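import Summits.Ventures.CertifiedManyBodySolver.Observables.StiffnessVirtualStationFanBoxes
import HarnessLib

/-!
# Ventures/CertifiedManyBodySolver — Observables/StiffnessVirtualStationSecantFanBoxes.lean

HONEST FRAMING: one-sided certified CEILINGS on the uniform flux stiffness (t–t′ f-sum class) at HALF FILLING, AREA form: the «VS × FAN» box theorems of the companion
`Observables/StiffnessVirtualStationFanBoxes.lean` (hubbard-fast-reuse-2 g9, §2) with the virtual station's `t′ = 0` cap taken as an AFFINE function `h₀ + h₁·U` on the
box's `U`-interval (a SECANT of the concave map `U ↦ e(1,0,U,1)` through one certified cap and one outer certified floor — `Observables/StiffnessVirtualStationSecantCaps.lean`,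
this seat g10 — or the g9 monotone cap in affine dress) instead of one constant cap from a coupling above the box; every leaf is CONDITIONAL on the rows and fan nodes it
names; a ceiling never speaks to the presence of order; not a `T_c` estimate, not a superconductivity verdict; no number of record. Zero compute, no definition, no claim node,
no `sorry`.

Cell `pub/hubbard-fast` (D-0154 (1)(A) «CERTIFICATE REUSE along parameter paths»), seat `hubbard-fast-reuse-2` g10 (`prover-hubbard-fast-reuse-2-g10-0`), line «SECANT CAPS»,
object (F′).

THE POINT. In the cleared word inequality `P(U, t′) ≥ 0` of the companion the cap enters only through the factor `(U·lo₁ − U₁·hi)`; with `hi ↦ h₀ + h₁U` that factor stays affine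
in `U`, so `P(·, t′)` is STILL a quadratic in `U` — leading coefficient `q(t′) = 2s₂A₂t′ − 2h₁U₁t′ + h₁U₁s₂ − 8v₂t′ + 2lo₁t′ − lo₁s₂ − 4cs₂` (the g9 `q` plus `h₁U₁(s₂ − 2t′)`),
still affine in `t′` — and quadratic in `t′` at fixed `U`; g6's `quadraticU_nonneg_on_box` words the box from the two `U`-edge families exactly as before (the companion's
cleared point leaves `…_fanPriced_leftLeaf_cleared` / `…_mirrorFanPriced_rightLeaf_cleared` are reused verbatim at the point, with the cap `h₀ + h₁U` there by evenness +
concavity in `t′`, `energyDensityTT'_halfFilling_cap_of_tPrime_zero_cap_above` with `U₂ := U`).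

* `ObsStiffnessSeqCeilingAt_on_box_halfFilling_virtualStation_fanPriced_left_affineCap` (`t′ ≤ 0`) / `…_mirrorFanPriced_right_affineCap` (`t′ ≥ 0`, all sides).

NOT said: the free fan orientation is not boxed; nothing at `T > 0`; `λ ≠ 0` words are not of this form.

References: T. Koma, H. Tasaki, J. Stat. Phys. 76 (1994) 745, §1 [KomaTasaki1994]; D. J. Scalapino, S. R. White, S.-C. Zhang, PRB 47 (1993) 7995, §II
[ScalapinoWhiteZhang1993]; E. H. Lieb, F. Y. Wu, Physica A 321 (2003) 1, §1 eq. (3) [LiebWuPhysicaA2003]; D. Ruelle, Statistical Mechanics: Rigorous Results (1969),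
§3.3 [Ruelle1969].
-/

noncomputable section

namespace Summit.Ventures.CertifiedManyBodySolver.Observables

open Literature.MathematicalPhysics.QuantumLattice
open Literature.MathematicalPhysics.QuantumLattice.ThermodynamicLimit
open Literature.MathematicalPhysics.QuantumFieldTheory
open Literature.Probability.LatticeModels
open Matrix Finset Filter Topology HubbardWave0
open scoped Matrix BigOperators ComplexOrder

/-! ## The box theorems (PRICED fan orientation) with an affine cap on the `U`-interval -/

section Box

variable {U₁ lo₁ s₂ U₂ : ℝ}

/-- **VS × FAN BOX, `t′ ≤ 0`, PRICED, affine cap** (`n = 1`). Chord floor `lo₁ ≤ e(1, 0, U₁, 1)` (`0 ≤ U₁ < U_a`), an AFFINE `t′ = 0` cap on the `U`-interval (`e(1, 0, U, 1) ≤ h₀ + h₁U` for `U ∈ [U_a, U_b]`, e.g. a SECANT of `Observables/StiffnessVirtualStationSecantCaps`; a cap at every point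
of the box by evenness + concavity in `t′` at the point's own coupling); fan class `(s₂, U_B, 1)` (`0 ≤ U_B < U_a`) with own family `v₂` and ceiling `A₂`; box `U_a < U_b`, `t_a < t_b ≤ 0`; at the four
corners `K_B ≤ 2s₂ d_B` (affine) and `K_B < 2t′d_B` (bilinear); on the two `U`-edges, for every `t′ ∈ [t_a, t_b]`: `0 ≤ P(U_e, t′)` and `0 ≤ P(U_e, t′) − q(t′)(U_b − U_a)²/4` with
`q(t′) = 2s₂A₂t′ − 2h₁U₁t′ + h₁U₁s₂ − 8v₂t′ + 2lo₁t′ − lo₁s₂ − 4cs₂` the leading coefficient of `P(·, t′)` (still a quadratic in `U`: the cap enters through the affine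
factor `U·lo₁ − U₁(h₀ + h₁U)`). Then `ObsStiffnessSeqCeilingAt t′ U 1 c` at every point of the box
(`quadraticU_nonneg_on_box` at fixed `t′`, then §1). [cite: KomaTasaki1994, §1] [cite: ScalapinoWhiteZhang1993, §II] [cite: LiebWuPhysicaA2003, §1 eq. (3)] -/
theorem ObsStiffnessSeqCeilingAt_on_box_halfFilling_virtualStation_fanPriced_left_affineCap (Uo₂ : ℝ) (hU₁0 : 0 ≤ U₁)
    (hfloor : lo₁ ≤ energyDensityTT' 1 0 U₁ 1) {h₀ h₁ : ℝ}
    (hU₂0 : 0 ≤ U₂) {v₂ : ℝ}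
    (h₂ : ∀ (ω : InfVolFermionState 2) (Ls : ℕ → ℕ) (ψ : ∀ L, Fock (Orb (FermionTorus 2 L))),
      Tendsto Ls atTop atTop →
      (∀ j, IsGroundStateInSector (hubbardTorusTT' (Ls j) 1 s₂ U₂) (rectN 1 (Ls j)) 0 (ψ (Ls j))) →
      (∀ j, star (ψ (Ls j)) ⬝ᵥ ψ (Ls j) = 1) → ω.IsTorusLimitOf ψ Ls →
      v₂ ≤ ((Finset.univ : Finset (DihedralGroup 4)).card : ℝ)⁻¹ * ∑ g ∈ (Finset.univ : Finset (DihedralGroup 4)),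
        (ω.expect (d4ShiftSet g 0 (box 2 7)) (fermionEmbed (PolySite.d4Emb g 0 (box 2 7)) (-oddMomentObsTT s₂ Uo₂ 0))).re)
    {A₂ : ℝ}
    (hA₂ : ∀ (ω : InfVolFermionState 2) (Ls : ℕ → ℕ) (ψ : ∀ L, Fock (Orb (FermionTorus 2 L))),
      Tendsto Ls atTop atTop →
      (∀ j, IsGroundStateInSector (hubbardTorusTT' (Ls j) 1 s₂ U₂) (rectN 1 (Ls j)) 0 (ψ (Ls j))) →
      (∀ j, star (ψ (Ls j)) ⬝ᵥ ψ (Ls j) = 1) → ω.IsTorusLimitOf ψ Ls →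
      ω.meanEnergy (hubbardTTPrimeFermionInteraction 0 1 0) 1 ≤ A₂)
    {Ua Ub ta tb : ℝ} (hUa : U₁ < Ua) (hUBa : U₂ < Ua) (hab : Ua < Ub) (hcap0 : ∀ U ∈ Set.Icc Ua Ub, energyDensityTT' 1 0 U 1 ≤ h₀ + h₁ * U) (htab : ta < tb) (htb : tb ≤ 0)
    (hpr₁ : Ua * s₂ - U₂ * ta ≤ 2 * s₂ * (Ua - U₂)) (hpr₂ : Ua * s₂ - U₂ * tb ≤ 2 * s₂ * (Ua - U₂))
    (hpr₃ : Ub * s₂ - U₂ * ta ≤ 2 * s₂ * (Ub - U₂)) (hpr₄ : Ub * s₂ - U₂ * tb ≤ 2 * s₂ * (Ub - U₂))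
    (hlf₁ : Ua * s₂ - U₂ * ta < 2 * ta * (Ua - U₂)) (hlf₂ : Ua * s₂ - U₂ * tb < 2 * tb * (Ua - U₂))
    (hlf₃ : Ub * s₂ - U₂ * ta < 2 * ta * (Ub - U₂)) (hlf₄ : Ub * s₂ - U₂ * tb < 2 * tb * (Ub - U₂)) (c : ℚ)
    (hPa : ∀ t ∈ Set.Icc ta tb, 0 ≤ 4 * ((c : ℚ) : ℝ) * ((-(U₁ * t)) * (Ua - U₂) - (Ua * s₂ - U₂ * t) * (Ua - U₁)) +
      (2 * t * (Ua - U₂) - (Ua * s₂ - U₂ * t)) * (Ua * lo₁ - U₁ * (h₀ + h₁ * Ua)) +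
      ((-(U₁ * t)) - 2 * t * (Ua - U₁)) * (4 * v₂ * (Ua - U₂) + ((Ua * s₂ - U₂ * t) - 2 * s₂ * (Ua - U₂)) * A₂))
    (hPb : ∀ t ∈ Set.Icc ta tb, 0 ≤ 4 * ((c : ℚ) : ℝ) * ((-(U₁ * t)) * (Ub - U₂) - (Ub * s₂ - U₂ * t) * (Ub - U₁)) +
      (2 * t * (Ub - U₂) - (Ub * s₂ - U₂ * t)) * (Ub * lo₁ - U₁ * (h₀ + h₁ * Ub)) +
      ((-(U₁ * t)) - 2 * t * (Ub - U₁)) * (4 * v₂ * (Ub - U₂) + ((Ub * s₂ - U₂ * t) - 2 * s₂ * (Ub - U₂)) * A₂))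
    (hQa : ∀ t ∈ Set.Icc ta tb, 0 ≤ 4 * ((c : ℚ) : ℝ) * ((-(U₁ * t)) * (Ua - U₂) - (Ua * s₂ - U₂ * t) * (Ua - U₁)) +
      (2 * t * (Ua - U₂) - (Ua * s₂ - U₂ * t)) * (Ua * lo₁ - U₁ * (h₀ + h₁ * Ua)) +
      ((-(U₁ * t)) - 2 * t * (Ua - U₁)) * (4 * v₂ * (Ua - U₂) + ((Ua * s₂ - U₂ * t) - 2 * s₂ * (Ua - U₂)) * A₂) -
      (2 * s₂ * A₂ * t - 2 * h₁ * U₁ * t + h₁ * U₁ * s₂ - 8 * v₂ * t + 2 * lo₁ * t - lo₁ * s₂ - 4 * ((c : ℚ) : ℝ) * s₂) * ((Ub - Ua) ^ 2 / 4))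
    (hQb : ∀ t ∈ Set.Icc ta tb, 0 ≤ 4 * ((c : ℚ) : ℝ) * ((-(U₁ * t)) * (Ub - U₂) - (Ub * s₂ - U₂ * t) * (Ub - U₁)) +
      (2 * t * (Ub - U₂) - (Ub * s₂ - U₂ * t)) * (Ub * lo₁ - U₁ * (h₀ + h₁ * Ub)) +
      ((-(U₁ * t)) - 2 * t * (Ub - U₁)) * (4 * v₂ * (Ub - U₂) + ((Ub * s₂ - U₂ * t) - 2 * s₂ * (Ub - U₂)) * A₂) -
      (2 * s₂ * A₂ * t - 2 * h₁ * U₁ * t + h₁ * U₁ * s₂ - 8 * v₂ * t + 2 * lo₁ * t - lo₁ * s₂ - 4 * ((c : ℚ) : ℝ) * s₂) * ((Ub - Ua) ^ 2 / 4)) :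
    ∀ U ∈ Set.Icc Ua Ub, ∀ t ∈ Set.Icc ta tb, ObsStiffnessSeqCeilingAt t U 1 c := by
  intro U hU t ht
  have hUa0 : 0 ≤ Ua := hU₁0.trans hUa.le
  have hpos : 0 < (Ub - Ua) * (tb - ta) := mul_pos (sub_pos.2 hab) (sub_pos.2 htab)
  -- side conditions at (U, t) by corner interpolation
  have hpr : U * s₂ - U₂ * t ≤ 2 * s₂ * (U - U₂) := by
    have h := box_corner_interp hU ht (sub_nonneg.2 hpr₁) (sub_nonneg.2 hpr₂) (sub_nonneg.2 hpr₃) (sub_nonneg.2 hpr₄)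
    have key : (Ub - Ua) * (tb - ta) * (2 * s₂ * (U - U₂) - (U * s₂ - U₂ * t)) =
        (Ub - U) * (tb - t) * (2 * s₂ * (Ua - U₂) - (Ua * s₂ - U₂ * ta)) + (Ub - U) * (t - ta) * (2 * s₂ * (Ua - U₂) - (Ua * s₂ - U₂ * tb)) +
        (U - Ua) * (tb - t) * (2 * s₂ * (Ub - U₂) - (Ub * s₂ - U₂ * ta)) + (U - Ua) * (t - ta) * (2 * s₂ * (Ub - U₂) - (Ub * s₂ - U₂ * tb)) := by
      ring
    have hnn : 0 ≤ (Ub - Ua) * (tb - ta) * (2 * s₂ * (U - U₂) - (U * s₂ - U₂ * t)) := by rw [key]; exact h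
    have := (mul_nonneg_iff_of_pos_left hpos).1 hnn
    linarith
  have hlf : U * s₂ - U₂ * t < 2 * t * (U - U₂) := by
    -- strict: interpolate the nonnegative slacks, at least one corner weight is positive
    obtain ⟨hUa', hUb'⟩ := hU
    obtain ⟨hta', htb'⟩ := ht
    have key : (Ub - Ua) * (tb - ta) * (2 * t * (U - U₂) - (U * s₂ - U₂ * t)) =
        (Ub - U) * (tb - t) * (2 * ta * (Ua - U₂) - (Ua * s₂ - U₂ * ta)) + (Ub - U) * (t - ta) * (2 * tb * (Ua - U₂) - (Ua * s₂ - U₂ * tb)) +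
        (U - Ua) * (tb - t) * (2 * ta * (Ub - U₂) - (Ub * s₂ - U₂ * ta)) + (U - Ua) * (t - ta) * (2 * tb * (Ub - U₂) - (Ub * s₂ - U₂ * tb)) := by
      ring
    set m := min (min (2 * ta * (Ua - U₂) - (Ua * s₂ - U₂ * ta)) (2 * tb * (Ua - U₂) - (Ua * s₂ - U₂ * tb)))
      (min (2 * ta * (Ub - U₂) - (Ub * s₂ - U₂ * ta)) (2 * tb * (Ub - U₂) - (Ub * s₂ - U₂ * tb))) with hm
    have hm0 : 0 < m := by
      simp only [hm, lt_min_iff]; exact ⟨⟨by linarith, by linarith⟩, ⟨by linarith, by linarith⟩⟩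
    have hm1 : m ≤ 2 * ta * (Ua - U₂) - (Ua * s₂ - U₂ * ta) := le_trans (min_le_left _ _) (min_le_left _ _)
    have hm2 : m ≤ 2 * tb * (Ua - U₂) - (Ua * s₂ - U₂ * tb) := le_trans (min_le_left _ _) (min_le_right _ _)
    have hm3 : m ≤ 2 * ta * (Ub - U₂) - (Ub * s₂ - U₂ * ta) := le_trans (min_le_right _ _) (min_le_left _ _)
    have hm4 : m ≤ 2 * tb * (Ub - U₂) - (Ub * s₂ - U₂ * tb) := le_trans (min_le_right _ _) (min_le_right _ _)
    have hw : (Ub - U) * (tb - t) + (Ub - U) * (t - ta) + (U - Ua) * (tb - t) + (U - Ua) * (t - ta) = (Ub - Ua) * (tb - ta) := by ring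
    have hge : m * ((Ub - Ua) * (tb - ta)) ≤ (Ub - Ua) * (tb - ta) * (2 * t * (U - U₂) - (U * s₂ - U₂ * t)) := by
      rw [key, ← hw]
      nlinarith [mul_nonneg (sub_nonneg.2 hUb') (sub_nonneg.2 htb'), mul_nonneg (sub_nonneg.2 hUb') (sub_nonneg.2 hta'),
        mul_nonneg (sub_nonneg.2 hUa') (sub_nonneg.2 htb'), mul_nonneg (sub_nonneg.2 hUa') (sub_nonneg.2 hta')]
    have h2 : 0 < (Ub - Ua) * (tb - ta) * (2 * t * (U - U₂) - (U * s₂ - U₂ * t)) := lt_of_lt_of_le (mul_pos hm0 hpos) hge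
    have := (mul_pos_iff_of_pos_left hpos).1 h2
    linarith
  have hcapU : energyDensityTT' 1 t U 1 ≤ h₀ + h₁ * U :=
    energyDensityTT'_halfFilling_cap_of_tPrime_zero_cap_above t (hUa0.trans hU.1) le_rfl (hcap0 U hU)
  refine ObsStiffnessSeqCeilingAt_halfFilling_virtualStation_fanPriced_leftLeaf_cleared Uo₂ hU₁0 (hUa.trans_le hU.1) hfloor hcapU hU₂0 h₂ hA₂
    (hUBa.trans_le hU.1) (ht.2.trans htb) hpr hlf c ?_
  -- P(U, t) = q U² + p U + r; g6's quadratic-in-U box lemma with the two edge families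
  set q : ℝ := 2 * s₂ * A₂ * t - 2 * h₁ * U₁ * t + h₁ * U₁ * s₂ - 8 * v₂ * t + 2 * lo₁ * t - lo₁ * s₂ - 4 * ((c : ℚ) : ℝ) * s₂ with hq
  set p : ℝ := 2 * U₂ * A₂ * t ^ 2 - 4 * s₂ * U₂ * A₂ * t - U₁ * s₂ * A₂ * t + h₁ * U₁ * U₂ * t + 8 * U₂ * v₂ * t + 4 * U₁ * v₂ * t - 2 * h₀ * U₁ * t +
    h₀ * U₁ * s₂ - lo₁ * U₂ * t + 4 * ((c : ℚ) : ℝ) * U₂ * t - 4 * ((c : ℚ) : ℝ) * U₁ * t + 4 * ((c : ℚ) : ℝ) * U₁ * s₂ with hp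
  set r : ℝ := -(U₁ * U₂ * A₂ * t ^ 2) + 2 * U₁ * s₂ * U₂ * A₂ * t - 4 * U₁ * U₂ * v₂ * t + h₀ * U₁ * U₂ * t with hr
  have hPid : ∀ X : ℝ, 4 * ((c : ℚ) : ℝ) * ((-(U₁ * t)) * (X - U₂) - (X * s₂ - U₂ * t) * (X - U₁)) +
      (2 * t * (X - U₂) - (X * s₂ - U₂ * t)) * (X * lo₁ - U₁ * (h₀ + h₁ * X)) +
      ((-(U₁ * t)) - 2 * t * (X - U₁)) * (4 * v₂ * (X - U₂) + ((X * s₂ - U₂ * t) - 2 * s₂ * (X - U₂)) * A₂) = q * X ^ 2 + p * X + r := by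
    intro X; rw [hq, hp, hr]; ring
  have ha := hPa t ht; have hb := hPb t ht; have haW := hQa t ht; have hbW := hQb t ht
  rw [hPid Ua] at ha haW; rw [hPid Ub] at hb hbW
  rw [hPid U]
  exact quadraticU_nonneg_on_box hab hU ha hb (by linarith) (by linarith)

/-- **VS × MIRRORED FAN BOX, `t′ ≥ 0`, PRICED, affine cap** (`n = 1`, all sides). Same data (affine `t′ = 0` cap on `[U_a, U_b]`); box `U_a < U_b`, `0 ≤ t_a < t_b`; corners: `−K_B⁺ ≤ 2s₂ d_B` and `2t′d_B < K_B⁺`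
(`K_B⁺ = U(−s₂) − U_B t′`); edges: `0 ≤ P⁺(U_e, t′)` and `0 ≤ P⁺(U_e, t′) − q⁺(t′)(U_b − U_a)²/4` with `q⁺(t′) = −2s₂A₂t′ + 2h₁U₁t′ + h₁U₁s₂ + 8v₂t′ − 2lo₁t′ − lo₁s₂ − 4cs₂`. Then
`ObsStiffnessSeqCeilingAt t′ U 1 c` on the box. [cite: KomaTasaki1994, §1] [cite: LiebWuPhysicaA2003, §1 eq. (3)] -/
theorem ObsStiffnessSeqCeilingAt_on_box_halfFilling_virtualStation_mirrorFanPriced_right_affineCap (Uo₂ : ℝ) (hU₁0 : 0 ≤ U₁)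
    (hfloor : lo₁ ≤ energyDensityTT' 1 0 U₁ 1) {h₀ h₁ : ℝ}
    (hU₂0 : 0 ≤ U₂) {v₂ : ℝ}
    (h₂ : ∀ (ω : InfVolFermionState 2) (Ls : ℕ → ℕ) (ψ : ∀ L, Fock (Orb (FermionTorus 2 L))),
      Tendsto Ls atTop atTop →
      (∀ j, IsGroundStateInSector (hubbardTorusTT' (Ls j) 1 s₂ U₂) (rectN 1 (Ls j)) 0 (ψ (Ls j))) →
      (∀ j, star (ψ (Ls j)) ⬝ᵥ ψ (Ls j) = 1) → ω.IsTorusLimitOf ψ Ls →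
      v₂ ≤ ((Finset.univ : Finset (DihedralGroup 4)).card : ℝ)⁻¹ * ∑ g ∈ (Finset.univ : Finset (DihedralGroup 4)),
        (ω.expect (d4ShiftSet g 0 (box 2 7)) (fermionEmbed (PolySite.d4Emb g 0 (box 2 7)) (-oddMomentObsTT s₂ Uo₂ 0))).re)
    {A₂ : ℝ}
    (hA₂ : ∀ (ω : InfVolFermionState 2) (Ls : ℕ → ℕ) (ψ : ∀ L, Fock (Orb (FermionTorus 2 L))),
      Tendsto Ls atTop atTop →
      (∀ j, IsGroundStateInSector (hubbardTorusTT' (Ls j) 1 s₂ U₂) (rectN 1 (Ls j)) 0 (ψ (Ls j))) →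
      (∀ j, star (ψ (Ls j)) ⬝ᵥ ψ (Ls j) = 1) → ω.IsTorusLimitOf ψ Ls →
      ω.meanEnergy (hubbardTTPrimeFermionInteraction 0 1 0) 1 ≤ A₂)
    {Ua Ub ta tb : ℝ} (hUa : U₁ < Ua) (hUBa : U₂ < Ua) (hab : Ua < Ub) (hcap0 : ∀ U ∈ Set.Icc Ua Ub, energyDensityTT' 1 0 U 1 ≤ h₀ + h₁ * U) (htab : ta < tb) (hta : 0 ≤ ta)
    (hpr₁ : -(Ua * (-s₂) - U₂ * ta) ≤ 2 * s₂ * (Ua - U₂)) (hpr₂ : -(Ua * (-s₂) - U₂ * tb) ≤ 2 * s₂ * (Ua - U₂))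
    (hpr₃ : -(Ub * (-s₂) - U₂ * ta) ≤ 2 * s₂ * (Ub - U₂)) (hpr₄ : -(Ub * (-s₂) - U₂ * tb) ≤ 2 * s₂ * (Ub - U₂))
    (hrt₁ : 2 * ta * (Ua - U₂) < Ua * (-s₂) - U₂ * ta) (hrt₂ : 2 * tb * (Ua - U₂) < Ua * (-s₂) - U₂ * tb)
    (hrt₃ : 2 * ta * (Ub - U₂) < Ub * (-s₂) - U₂ * ta) (hrt₄ : 2 * tb * (Ub - U₂) < Ub * (-s₂) - U₂ * tb) (c : ℚ)
    (hPa : ∀ t ∈ Set.Icc ta tb, 0 ≤ 4 * ((c : ℚ) : ℝ) * ((Ua * (-s₂) - U₂ * t) * (Ua - U₁) - (-(U₁ * t)) * (Ua - U₂)) +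
      ((Ua * (-s₂) - U₂ * t) - 2 * t * (Ua - U₂)) * (Ua * lo₁ - U₁ * (h₀ + h₁ * Ua)) +
      (2 * t * (Ua - U₁) - (-(U₁ * t))) * (4 * v₂ * (Ua - U₂) + (-(Ua * (-s₂) - U₂ * t) - 2 * s₂ * (Ua - U₂)) * A₂))
    (hPb : ∀ t ∈ Set.Icc ta tb, 0 ≤ 4 * ((c : ℚ) : ℝ) * ((Ub * (-s₂) - U₂ * t) * (Ub - U₁) - (-(U₁ * t)) * (Ub - U₂)) +
      ((Ub * (-s₂) - U₂ * t) - 2 * t * (Ub - U₂)) * (Ub * lo₁ - U₁ * (h₀ + h₁ * Ub)) +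
      (2 * t * (Ub - U₁) - (-(U₁ * t))) * (4 * v₂ * (Ub - U₂) + (-(Ub * (-s₂) - U₂ * t) - 2 * s₂ * (Ub - U₂)) * A₂))
    (hQa : ∀ t ∈ Set.Icc ta tb, 0 ≤ 4 * ((c : ℚ) : ℝ) * ((Ua * (-s₂) - U₂ * t) * (Ua - U₁) - (-(U₁ * t)) * (Ua - U₂)) +
      ((Ua * (-s₂) - U₂ * t) - 2 * t * (Ua - U₂)) * (Ua * lo₁ - U₁ * (h₀ + h₁ * Ua)) +
      (2 * t * (Ua - U₁) - (-(U₁ * t))) * (4 * v₂ * (Ua - U₂) + (-(Ua * (-s₂) - U₂ * t) - 2 * s₂ * (Ua - U₂)) * A₂) -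
      (-(2 * s₂ * A₂ * t) + 2 * h₁ * U₁ * t + h₁ * U₁ * s₂ + 8 * v₂ * t - 2 * lo₁ * t - lo₁ * s₂ - 4 * ((c : ℚ) : ℝ) * s₂) * ((Ub - Ua) ^ 2 / 4))
    (hQb : ∀ t ∈ Set.Icc ta tb, 0 ≤ 4 * ((c : ℚ) : ℝ) * ((Ub * (-s₂) - U₂ * t) * (Ub - U₁) - (-(U₁ * t)) * (Ub - U₂)) +
      ((Ub * (-s₂) - U₂ * t) - 2 * t * (Ub - U₂)) * (Ub * lo₁ - U₁ * (h₀ + h₁ * Ub)) +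
      (2 * t * (Ub - U₁) - (-(U₁ * t))) * (4 * v₂ * (Ub - U₂) + (-(Ub * (-s₂) - U₂ * t) - 2 * s₂ * (Ub - U₂)) * A₂) -
      (-(2 * s₂ * A₂ * t) + 2 * h₁ * U₁ * t + h₁ * U₁ * s₂ + 8 * v₂ * t - 2 * lo₁ * t - lo₁ * s₂ - 4 * ((c : ℚ) : ℝ) * s₂) * ((Ub - Ua) ^ 2 / 4)) :
    ∀ U ∈ Set.Icc Ua Ub, ∀ t ∈ Set.Icc ta tb, ObsStiffnessSeqCeilingAt t U 1 c := by
  intro U hU t ht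
  have hUa0 : 0 ≤ Ua := hU₁0.trans hUa.le
  have hpos : 0 < (Ub - Ua) * (tb - ta) := mul_pos (sub_pos.2 hab) (sub_pos.2 htab)
  have hpr : -(U * (-s₂) - U₂ * t) ≤ 2 * s₂ * (U - U₂) := by
    have h := box_corner_interp hU ht (sub_nonneg.2 hpr₁) (sub_nonneg.2 hpr₂) (sub_nonneg.2 hpr₃) (sub_nonneg.2 hpr₄)
    have key : (Ub - Ua) * (tb - ta) * (2 * s₂ * (U - U₂) - -(U * (-s₂) - U₂ * t)) =
        (Ub - U) * (tb - t) * (2 * s₂ * (Ua - U₂) - -(Ua * (-s₂) - U₂ * ta)) + (Ub - U) * (t - ta) * (2 * s₂ * (Ua - U₂) - -(Ua * (-s₂) - U₂ * tb)) +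
        (U - Ua) * (tb - t) * (2 * s₂ * (Ub - U₂) - -(Ub * (-s₂) - U₂ * ta)) + (U - Ua) * (t - ta) * (2 * s₂ * (Ub - U₂) - -(Ub * (-s₂) - U₂ * tb)) := by
      ring
    have hnn : 0 ≤ (Ub - Ua) * (tb - ta) * (2 * s₂ * (U - U₂) - -(U * (-s₂) - U₂ * t)) := by rw [key]; exact h
    have := (mul_nonneg_iff_of_pos_left hpos).1 hnn
    linarith
  have hrt : 2 * t * (U - U₂) < U * (-s₂) - U₂ * t := by
    obtain ⟨hUa', hUb'⟩ := hU
    obtain ⟨hta', htb'⟩ := ht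
    have key : (Ub - Ua) * (tb - ta) * ((U * (-s₂) - U₂ * t) - 2 * t * (U - U₂)) =
        (Ub - U) * (tb - t) * ((Ua * (-s₂) - U₂ * ta) - 2 * ta * (Ua - U₂)) + (Ub - U) * (t - ta) * ((Ua * (-s₂) - U₂ * tb) - 2 * tb * (Ua - U₂)) +
        (U - Ua) * (tb - t) * ((Ub * (-s₂) - U₂ * ta) - 2 * ta * (Ub - U₂)) + (U - Ua) * (t - ta) * ((Ub * (-s₂) - U₂ * tb) - 2 * tb * (Ub - U₂)) := by
      ring
    set m := min (min ((Ua * (-s₂) - U₂ * ta) - 2 * ta * (Ua - U₂)) ((Ua * (-s₂) - U₂ * tb) - 2 * tb * (Ua - U₂)))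
      (min ((Ub * (-s₂) - U₂ * ta) - 2 * ta * (Ub - U₂)) ((Ub * (-s₂) - U₂ * tb) - 2 * tb * (Ub - U₂))) with hm
    have hm0 : 0 < m := by
      simp only [hm, lt_min_iff]; exact ⟨⟨by linarith, by linarith⟩, ⟨by linarith, by linarith⟩⟩
    have hm1 : m ≤ (Ua * (-s₂) - U₂ * ta) - 2 * ta * (Ua - U₂) := le_trans (min_le_left _ _) (min_le_left _ _)
    have hm2 : m ≤ (Ua * (-s₂) - U₂ * tb) - 2 * tb * (Ua - U₂) := le_trans (min_le_left _ _) (min_le_right _ _)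
    have hm3 : m ≤ (Ub * (-s₂) - U₂ * ta) - 2 * ta * (Ub - U₂) := le_trans (min_le_right _ _) (min_le_left _ _)
    have hm4 : m ≤ (Ub * (-s₂) - U₂ * tb) - 2 * tb * (Ub - U₂) := le_trans (min_le_right _ _) (min_le_right _ _)
    have hw : (Ub - U) * (tb - t) + (Ub - U) * (t - ta) + (U - Ua) * (tb - t) + (U - Ua) * (t - ta) = (Ub - Ua) * (tb - ta) := by ring
    have hge : m * ((Ub - Ua) * (tb - ta)) ≤ (Ub - Ua) * (tb - ta) * ((U * (-s₂) - U₂ * t) - 2 * t * (U - U₂)) := by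
      rw [key, ← hw]
      nlinarith [mul_nonneg (sub_nonneg.2 hUb') (sub_nonneg.2 htb'), mul_nonneg (sub_nonneg.2 hUb') (sub_nonneg.2 hta'),
        mul_nonneg (sub_nonneg.2 hUa') (sub_nonneg.2 htb'), mul_nonneg (sub_nonneg.2 hUa') (sub_nonneg.2 hta')]
    have h2 : 0 < (Ub - Ua) * (tb - ta) * ((U * (-s₂) - U₂ * t) - 2 * t * (U - U₂)) := lt_of_lt_of_le (mul_pos hm0 hpos) hge
    have := (mul_pos_iff_of_pos_left hpos).1 h2
    linarith
  have hcapU : energyDensityTT' 1 t U 1 ≤ h₀ + h₁ * U :=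
    energyDensityTT'_halfFilling_cap_of_tPrime_zero_cap_above t (hUa0.trans hU.1) le_rfl (hcap0 U hU)
  refine ObsStiffnessSeqCeilingAt_halfFilling_virtualStation_mirrorFanPriced_rightLeaf_cleared Uo₂ hU₁0 (hUa.trans_le hU.1) hfloor hcapU hU₂0 h₂ hA₂
    (hUBa.trans_le hU.1) (hta.trans ht.1) hpr hrt c ?_
  set q : ℝ := -(2 * s₂ * A₂ * t) + 2 * h₁ * U₁ * t + h₁ * U₁ * s₂ + 8 * v₂ * t - 2 * lo₁ * t - lo₁ * s₂ - 4 * ((c : ℚ) : ℝ) * s₂ with hq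
  set p : ℝ := 2 * U₂ * A₂ * t ^ 2 + 4 * s₂ * U₂ * A₂ * t + U₁ * s₂ * A₂ * t - h₁ * U₁ * U₂ * t - 8 * U₂ * v₂ * t - 4 * U₁ * v₂ * t + 2 * h₀ * U₁ * t +
    h₀ * U₁ * s₂ + lo₁ * U₂ * t - 4 * ((c : ℚ) : ℝ) * U₂ * t + 4 * ((c : ℚ) : ℝ) * U₁ * t + 4 * ((c : ℚ) : ℝ) * U₁ * s₂ with hp
  set r : ℝ := -(U₁ * U₂ * A₂ * t ^ 2) - 2 * U₁ * s₂ * U₂ * A₂ * t + 4 * U₁ * U₂ * v₂ * t - h₀ * U₁ * U₂ * t with hr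
  have hPid : ∀ X : ℝ, 4 * ((c : ℚ) : ℝ) * ((X * (-s₂) - U₂ * t) * (X - U₁) - (-(U₁ * t)) * (X - U₂)) +
      ((X * (-s₂) - U₂ * t) - 2 * t * (X - U₂)) * (X * lo₁ - U₁ * (h₀ + h₁ * X)) +
      (2 * t * (X - U₁) - (-(U₁ * t))) * (4 * v₂ * (X - U₂) + (-(X * (-s₂) - U₂ * t) - 2 * s₂ * (X - U₂)) * A₂) = q * X ^ 2 + p * X + r := by
    intro X; rw [hq, hp, hr]; ring
  have ha := hPa t ht; have hb := hPb t ht; have haW := hQa t ht; have hbW := hQb t ht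
  rw [hPid Ua] at ha haW; rw [hPid Ub] at hb hbW
  rw [hPid U]
  exact quadraticU_nonneg_on_box hab hU ha hb (by linarith) (by linarith)

end Box

end Summit.Ventures.CertifiedManyBodySolver.Observables

end
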